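import Mathlib
import HarnessLib
import Summits.ResolutionOfSingularities.ResolutionOfSingularities.Theorems.WildQuotientsWildQuotientResolutionS1aKillFree

/-!
# S1a — K-FREE FRAME, path tools: the lexicographic drop from an embedding missing a top component; bad points off the support embed along ANY move

[OURS · L1 W4.5c · lead-1 g11; F12 / v12-KF, companion of `…S1aKillFree`] — NOT statements of the manuscript; counted 0; AI-level work, weaker than expert
review. Crux stmt-ResolutionOfSingularities-17941 `CyclicQuotientFourfolds`, line `s1a-logminvertex`. Route-independent; typed bad locus only.

How a leaf of a strategy tree is shown to have LOWER measure than the root `M` (the A-side's obligation in `ReachLowerIn`): compose, along the path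
root → leaf, the embeddings of bad loci given by the moves — (T3) a KILL move embeds ALL of `Z(M″)` onto `Z(M′) ∖ supp` (p620846); (T2) ANY move along a
`G`-stable centre embeds the bad points NOT LYING OVER THE SUPPORT onto `Z(M) ∖ supp` (this file) — and conclude with (T1): an embedding `Z(leaf) ↪ Z(M)`
whose range misses a set containing a TOP component of `Z(M)` forces `LexLT leaf M` (this file). So the leaf obligation is «no bad point of the leaf lies
over an earlier AUX support» — established by proving the points over the supports GOOD (killed / exited nodes), never by proving badness.

* ★ `GModel.lexLT_of_isEmbedding_missing_top` — (T1);
* ★ `GModel.exists_isEmbedding_badLocus_off_support` — (T2): for a move `π′ : M′ → M` blowing up the degree-`d` piece of a `G`-stable Rees filtration,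
  `{v′ ∈ Z(M′) | π′ v′ ∉ supp} ≃ Z(M) ∖ supp` (an embedding with exactly that range, `ψ v′ = π′ v′`);
* `GModel.lexLT_trans` — transitivity of the measure order (chaining sub-trees); `GModel.TreeIn.trans` — grafting trees.
-/

set_option linter.dupNamespace false

noncomputable section

open CategoryTheory Limits AlgebraicGeometry TopologicalSpace Topology
open Literature.AlgebraicGeometry.Resolution Literature.AlgebraicGeometry.RelativeSpec
open Summit.ResolutionOfSingularities.ResolutionOfSingularities.Theorems.WildQuotientResolution.S1
open Summit.ResolutionOfSingularities.ResolutionOfSingularities.Theorems.WildQuotientResolution.S1.NodeAtlas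
open Summit.ResolutionOfSingularities.ResolutionOfSingularities.Theorems.WildQuotientResolution.S1.CompCount
open Summit.ResolutionOfSingularities.ResolutionOfSingularities.Theorems.WildQuotientResolution.S1.TopComponents
open Summit.ResolutionOfSingularities.ResolutionOfSingularities.Theorems.WildQuotientResolution.S1.KillableTransport

namespace Summit.ResolutionOfSingularities.ResolutionOfSingularities.Theorems.WildQuotientResolution.S1.GameFrame.GModel

variable {p : ℕ} {X' X₁ : Scheme.{0}} {q : X' ⟶ X₁} {G : Type} [Group G] {ρ : G →* Aut X'} {g₀ : G}

/-! ## (T1) the lexicographic drop from an embedding missing a top component -/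

/-- ★ **(T1)** An embedding `ψ : Z(N) → Z(M)` whose range is disjoint from a set `F` containing a TOP-dimensional component of `Z(M)` forces
`LexLT N M` (`M` compact with `ν₁` finite). [OURS · L1 W4.5c · v12-KF] -/
theorem lexLT_of_isEmbedding_missing_top (N M : GModel p q G ρ g₀) [CompactSpace M.V] {n : ℕ} (hnu : M.nu1 < n)
    (ψ : ↥N.badLocus → ↥M.badLocus) (hψ : IsEmbedding ψ) {F : Set ↥M.badLocus} (hF : Disjoint (Set.range ψ) F)
    {t : Set ↥M.badLocus} (ht : t ∈ irreducibleComponents ↥M.badLocus) (hdt : topologicalKrullDim ↥t = M.nu1) (htF : t ⊆ F) :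
    LexLT N M := by
  have hle : N.nu1 ≤ M.nu1 := hψ.isInducing.topologicalKrullDim_le
  rcases hle.lt_or_eq with hlt | heq
  · exact Or.inl hlt
  have hbot : M.nu1 ≠ ⊥ := by
    intro hbot
    rw [nu1, topologicalKrullDim, Order.krullDim_eq_bot_iff] at hbot
    obtain ⟨x, -⟩ := ht.1.nonempty
    exact hbot.elim ⟨closure {x}, isIrreducible_singleton.closure, isClosed_closure⟩
  obtain ⟨k, hk⟩ := exists_nat_eq_of_ne_bot_of_lt hbot hnu
  exact Or.inr ⟨heq, Or.inl (TopCount.nTopComp_lt_of_isEmbedding hψ hk (heq.trans hk) M.finite_irreducibleComponents_badLocus hF ht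
    (hdt.trans hk) htF)⟩

/-- Transitivity of `LexLT`. -/
theorem lexLT_trans {A B C : GModel p q G ρ g₀} (h₁ : LexLT A B) (h₂ : LexLT B C) : LexLT A C := by
  rcases h₁ with a1 | ⟨a1, a2 | ⟨a2, a3⟩⟩ <;> rcases h₂ with b1 | ⟨b1, b2 | ⟨b2, b3⟩⟩
  · exact Or.inl (a1.trans b1)
  · exact Or.inl (b1 ▸ a1)
  · exact Or.inl (b1 ▸ a1)
  · exact Or.inl (a1 ▸ b1)
  · exact Or.inr ⟨a1.trans b1, Or.inl (a2.trans b2)⟩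
  · exact Or.inr ⟨a1.trans b1, Or.inl (b2 ▸ a2)⟩
  · exact Or.inl (a1 ▸ b1)
  · exact Or.inr ⟨a1.trans b1, Or.inl (a2 ▸ b2)⟩
  · exact Or.inr ⟨a1.trans b1, Or.inr ⟨a2.trans b2, a3.trans b3⟩⟩

/-- **Grafting trees**: a tree of depth `≤ n` whose leaves carry trees of depth `≤ m` with leaves in `Q'` is a tree of depth `≤ n + m` with leaves in `Q'`. -/
theorem TreeIn.trans {P Q Q' : GModel p q G ρ g₀ → Prop} {m : ℕ} (hQ : ∀ N : GModel p q G ρ g₀, Q N → TreeIn P Q' m N) :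
    ∀ (n : ℕ) (M : GModel p q G ρ g₀), TreeIn P Q n M → TreeIn P Q' (n + m) M
  | 0, M, h => by rw [Nat.zero_add]; exact hQ M h
  | n + 1, M, h => by
      rcases h with h | ⟨𝒦, d, hadm, hmv⟩
      · exact TreeIn.mono M (by omega) (hQ M h)
      · rw [Nat.add_right_comm]
        exact Or.inr ⟨𝒦, d, hadm, fun M' hm => ⟨(hmv M' hm).1, TreeIn.trans hQ n M' (hmv M' hm).2⟩⟩

/-! ## (T2) bad points off the support embed along any move -/

/-- ★ **(T2)** Along a move `π′ : M′ → M` blowing up the degree-`d` piece of a `G`-stable Rees filtration, the bad points of `M′` NOT lying over the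
support embed into `Z(M)` via `π′`, with range exactly `Z(M) ∖ supp` (`π′` is an isomorphism over the idle region; goodness transports both ways).
[OURS · L1 W4.5c · v12-KF] -/
theorem exists_isEmbedding_badLocus_off_support [Finite G] (hG : ∀ g : G, g ∈ Subgroup.zpowers g₀)
    (M M' : GModel p q G ρ g₀) (𝒦 : ReesFiltration M.V) (d : ℕ)
    (h𝒦G : ∀ g : G, (𝒦.ideal d).comap (M.act.aut g).hom = 𝒦.ideal d)
    (π' : M'.V ⟶ M.V) (hbl : IsBlowup π' (𝒦.ideal d)) (hr : M'.r = π' ≫ M.r)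
    (hcomm : ∀ g : G, (M'.act.aut g).hom ≫ π' = π' ≫ (M.act.aut g).hom) :
    ∃ ψ : ↥{v' ∈ M'.badLocus | π'.base v' ∉ ((𝒦.ideal d).support : Set M.V)} → ↥M.badLocus, IsEmbedding ψ ∧
      (∀ v', (ψ v' : M.V) = π'.base v'.1) ∧ Set.range ψ = {z : ↥M.badLocus | (z : M.V) ∉ ((𝒦.ideal d).support : Set M.V)} := by
  have hsuppG := fun g => preimage_support_compl_of_comap_eq M (I := 𝒦.ideal d) h𝒦G g
  let W : M.V.Opens := (𝒦.ideal d).support.compl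
  let D : Set M'.V := {v' ∈ M'.badLocus | π'.base v' ∉ ((𝒦.ideal d).support : Set M.V)}
  have hW : ∀ v' : ↥D, v'.1 ∈ π' ⁻¹ᵁ W := fun v' => v'.2.2
  have key : ∀ v' : ↥D, π'.base v'.1 ∈ M.badLocus := fun v' =>
    base_mem_badLocus_of_move M M' hG 𝒦 d π' hbl hr hcomm hsuppG v'.2.2 v'.2.1
  haveI hiso : IsIso (π' ∣_ W) := hbl.isIso_morphismRestrict (U := W) (by
    rw [Set.disjoint_iff]; rintro x ⟨hx, hx'⟩; exact hx hx')
  let e : ↥(π' ⁻¹ᵁ W) ≃ₜ ↥W := Scheme.homeoOfIso (asIso (π' ∣_ W))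
  let φ₀ : ↥D → M.V := fun v' => ((e ⟨v'.1, hW v'⟩ : ↥W) : M.V)
  have hφ₀ : ∀ v', φ₀ v' = π'.base v'.1 := fun v' => by
    have h1 : (e ⟨v'.1, hW v'⟩ : ↥W) = (π' ∣_ W).base ⟨v'.1, hW v'⟩ := rfl
    change ((e ⟨v'.1, hW v'⟩ : ↥W) : M.V) = _
    rw [h1]
    exact morphismRestrict_base_coe π' W ⟨v'.1, hW v'⟩
  have hind₀ : IsInducing φ₀ := by
    refine IsInducing.subtypeVal.comp (e.isInducing.comp ?_)
    exact (IsInducing.subtypeVal.codRestrict hW : IsInducing fun v' : ↥D => (⟨v'.1, hW v'⟩ : ↥(π' ⁻¹ᵁ W)))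
  have hinj₀ : Function.Injective φ₀ := by
    intro a b hab
    have h1 : (e ⟨a.1, hW a⟩ : ↥W) = e ⟨b.1, hW b⟩ := Subtype.ext hab
    have h2 := e.injective h1
    exact Subtype.ext (congrArg (fun x : ↥(π' ⁻¹ᵁ W) => (x : M'.V)) h2)
  have hmem₀ : ∀ v', φ₀ v' ∈ M.badLocus := fun v' => by rw [hφ₀]; exact key v'
  refine ⟨Set.codRestrict φ₀ M.badLocus hmem₀, ⟨hind₀.codRestrict hmem₀, (Set.injective_codRestrict hmem₀).mpr hinj₀⟩, fun v' => hφ₀ v', ?_⟩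
  ext z
  constructor
  · rintro ⟨v', rfl⟩
    change φ₀ v' ∉ _
    rw [hφ₀]
    exact v'.2.2
  · intro hz
    -- the unique preimage of `z` over the idle region is bad
    let w : ↥W := ⟨(z : M.V), hz⟩
    let v₀ : ↥(π' ⁻¹ᵁ W) := e.symm w
    have hv₀ : π'.base v₀.1 = z := by
      have h1 : ((e v₀ : ↥W) : M.V) = π'.base v₀.1 := by
        have h2 : (e v₀ : ↥W) = (π' ∣_ W).base v₀ := rfl
        rw [h2]; exact morphismRestrict_base_coe π' W v₀
      rw [← h1]
      change ((e (e.symm w) : ↥W) : M.V) = _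
      rw [e.apply_symm_apply]
    have hns : π'.base v₀.1 ∉ ((𝒦.ideal d).support : Set M.V) := by rw [hv₀]; exact hz
    have hbad : v₀.1 ∈ M'.badLocus := fun hgood =>
      z.2 (hv₀ ▸ isGoodAt_base_of_isGoodAt hG M M' 𝒦 d π' hbl hr hcomm hsuppG hns hgood)
    refine ⟨⟨v₀.1, hbad, hns⟩, Subtype.ext ?_⟩
    change φ₀ _ = _
    rw [hφ₀]
    exact hv₀

end Summit.ResolutionOfSingularities.ResolutionOfSingularities.Theorems.WildQuotientResolution.S1.GameFrame.GModel

end
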